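import Mathlib.Analysis.SpecialFunctions.Pow.Deriv
import Mathlib.Analysis.SpecialFunctions.Trigonometric.Bounds
import Mathlib.Analysis.Calculus.Deriv.MeanValue
import Mathlib.Topology.Order.Monotone
import HarnessLib

/-!
# Quasi-geodesic curves of the upper half-plane end non-tangentially

Support (hyperbolic geometry of `ℍ`, real-variable form) for the sector claim in the proof of
[LSW] Lemma 6.3 (G. F. Lawler, O. Schramm, W. Werner, *Conformal restriction: the chordal case*,
J. Amer. Math. Soc. **16** (2003), proof of Lemma 6.3: "`β̂(x) := g_T ∘ β(x) - W_T`, `x ∈ [0,1)`,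
is a path which is contained in a sector `|Re z| ≤ c Im z`"). In print the claim is proved by a
two-sided harmonic-measure (Brownian hitting) estimate and conformal invariance. The tree proves
it instead by hyperbolic geometry: the image curve `w(x) = g_T(β(x)) - W_T` is a quasi-geodesic of
`ℍ` — its hyperbolic speed is `O(1/(1-x))` (Schwarz–Pick on the inner cone of the smooth hull)
while hyperbolic distances between its points grow like `log((1-x₁)/(1-x₂))` (Koebe's one-quarter
theorem for `g_T⁻¹`) — and a quasi-geodesic of `ℍ` ending at `0` cannot approach `ℝ` tangentially
(a Morse-lemma type statement). This file is the purely real-variable core of that argument,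
written for the polar coordinates `ψ = arg w ∈ (0, π)` and `R = -log ‖w‖` of the curve:

* `IsQuasiGeodesic ψ ψ' R R' x₀ α β C` — the hypotheses: on `[x₀, 1)`, `ψ ∈ (0, π)` and `R` are
  differentiable with `|ψ'|, |R'| ≤ sin ψ · α/(1-x)` (hyperbolic speed `≤ α/(1-x)`), the
  *distance inequality* `β log((1-x₁)/(1-x₂)) - C ≤ crown (ψ x₁) + |R x₂ - R x₁| + crown (ψ x₂)`
  (the right-hand side is the hyperbolic length of the circle–axis–circle path between the two
  points `w(x₁)`, `w(x₂)`, `crown ψ = (π/2) log(π/(2 min(ψ, π-ψ)))` bounding the circular pieces by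
  Jordan's inequality), and `R → +∞` (`w → 0`);
* `IsQuasiGeodesic.eventually_le` — then `ψ ≥ δ > 0` near `1`;
* `IsQuasiGeodesic.eventually_mem_Icc` — and, by the symmetry `ψ ↦ π - ψ`, `δ ≤ ψ ≤ π - δ` near `1`.

Proof: with `sin δ' ≤ β/(2α)`, (1) `ψ` cannot stay below `δ'` up to `1`: it would force
`crown (ψ x) ≳ (β/2) log(1/(1-x))`, i.e. a power decay of `ψ`, whence `|R'|` integrable and `R`
bounded, contradicting `R → ∞`; (2) a dip of `ψ` below `δ'` between two crossings `x_a < x_b` of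
the level `δ'` has `log((1-x_a)/(1-x_b))` bounded (distance inequality against `|ΔR| ≤ α sin δ' ·
log`), so the angular potential `log tan(ψ/2)` (which is `α/(1-x)`-Lipschitz) drops by a bounded
amount inside the dip.

## References

* G. F. Lawler, O. Schramm, W. Werner, *Conformal restriction: the chordal case*, J. Amer. Math.
  Soc. 16 (2003), proof of Lemma 6.3. [LawlerSchrammWerner2003Restriction]
* Ch. Pommerenke, *Boundary Behaviour of Conformal Maps*, Springer (1992), §1.3, §4.5
  (hyperbolic metric, Koebe estimates). [PommerenkeBBCM1992]
-/

noncomputable section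

open Set Filter Real Topology

namespace Literature.Analysis.Complex

namespace QuasiGeodesic

/-! ### Derivative comparison -/

/-- **Comparison of increments**: if `|g'| ≤ B'` on `[a, b]` then `|g b - g a| ≤ B b - B a`.
[folklore] -/
theorem abs_sub_le_of_abs_deriv_le {g g' B B' : ℝ → ℝ} {a b : ℝ} (hab : a ≤ b)
    (hg : ∀ x ∈ Icc a b, HasDerivAt g (g' x) x) (hB : ∀ x ∈ Icc a b, HasDerivAt B (B' x) x)
    (hle : ∀ x ∈ Icc a b, |g' x| ≤ B' x) : |g b - g a| ≤ B b - B a := by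
  have hgc : ContinuousOn g (Icc a b) := fun x hx ↦ (hg x hx).continuousAt.continuousWithinAt
  have hBc : ContinuousOn B (Icc a b) := fun x hx ↦ (hB x hx).continuousAt.continuousWithinAt
  have hint : interior (Icc a b) ⊆ Icc a b := interior_subset
  have h₁ : MonotoneOn (fun x ↦ B x - g x) (Icc a b) := by
    refine monotoneOn_of_hasDerivWithinAt_nonneg (convex_Icc a b) (hBc.sub hgc)
      (fun x hx ↦ ((hB x (hint hx)).sub (hg x (hint hx))).hasDerivWithinAt) fun x hx ↦ ?_
    linarith [le_abs_self (g' x), hle x (hint hx)]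
  have h₂ : MonotoneOn (fun x ↦ B x + g x) (Icc a b) := by
    refine monotoneOn_of_hasDerivWithinAt_nonneg (convex_Icc a b) (hBc.add hgc)
      (fun x hx ↦ ((hB x (hint hx)).add (hg x (hint hx))).hasDerivWithinAt) fun x hx ↦ ?_
    linarith [neg_abs_le (g' x), hle x (hint hx)]
  have ha : a ∈ Icc a b := left_mem_Icc.2 hab
  have hb : b ∈ Icc a b := right_mem_Icc.2 hab
  have e₁ := h₁ ha hb hab
  have e₂ := h₂ ha hb hab
  simp only at e₁ e₂
  rw [abs_le]
  constructor <;> linarith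

/-! ### The angular potential `log tan(ψ/2)` and the crown length -/

/-- The **angular potential** `Φ(ψ) = log tan(ψ/2) = log sin ψ - log(1 + cos ψ)`, an
antiderivative of `1/sin ψ` on `(0, π)` (the hyperbolic length of the unit circle of `ℍ`
measured by the angle). [folklore] -/
def angPot (ψ : ℝ) : ℝ := Real.log (Real.sin ψ) - Real.log (1 + Real.cos ψ)

/-- `Φ' = 1/sin` on `(0, π)`. [folklore] -/
theorem hasDerivAt_angPot {ψ : ℝ} (h0 : 0 < ψ) (hπ : ψ < π) :
    HasDerivAt angPot (1 / Real.sin ψ) ψ := by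
  have hs : 0 < Real.sin ψ := Real.sin_pos_of_pos_of_lt_pi h0 hπ
  have hc : 0 < 1 + Real.cos ψ := by
    have : Real.cos π < Real.cos ψ := Real.cos_lt_cos_of_nonneg_of_le_pi h0.le le_rfl hπ
    rw [Real.cos_pi] at this
    linarith
  have h1 : HasDerivAt (fun x ↦ Real.log (Real.sin x)) (Real.cos ψ / Real.sin ψ) ψ :=
    (Real.hasDerivAt_sin ψ).log hs.ne'
  have h2 : HasDerivAt (fun x ↦ Real.log (1 + Real.cos x)) (-Real.sin ψ / (1 + Real.cos ψ)) ψ := by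
    have := ((Real.hasDerivAt_cos ψ).const_add 1).log hc.ne'
    simpa using this
  have h := h1.sub h2
  have heq : Real.cos ψ / Real.sin ψ - -Real.sin ψ / (1 + Real.cos ψ) = 1 / Real.sin ψ := by
    field_simp
    nlinarith [Real.sin_sq_add_cos_sq ψ]
  rw [heq] at h
  exact h

/-- `Φ(ψ) ≤ log ψ` for `0 < ψ ≤ π/2` (`tan(ψ/2) ≤ sin ψ ≤ ψ` there). [folklore] -/
theorem angPot_le_log {ψ : ℝ} (h0 : 0 < ψ) (h2 : ψ ≤ π / 2) : angPot ψ ≤ Real.log ψ := by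
  have hs : 0 < Real.sin ψ := Real.sin_pos_of_pos_of_lt_pi h0 (by linarith [Real.pi_pos])
  have hc : 0 ≤ Real.cos ψ := Real.cos_nonneg_of_neg_pi_div_two_le_of_le (by linarith [Real.pi_pos]) h2
  have h1 : 0 ≤ Real.log (1 + Real.cos ψ) := Real.log_nonneg (by linarith)
  have h3 : Real.log (Real.sin ψ) ≤ Real.log ψ := Real.log_le_log hs (Real.sin_le h0.le)
  unfold angPot
  linarith

/-- The **crown length** `(π/2) log(π / (2 min(ψ, π - ψ)))`: an upper bound (Jordan's inequality
`sin θ ≥ 2θ/π`) for the hyperbolic length `∫ dθ/sin θ` of the arc of a circle `|w| = ρ` of `ℍ`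
from the point of argument `ψ` to its top `iρ`. [folklore] -/
def crown (ψ : ℝ) : ℝ := π / 2 * Real.log (π / (2 * min ψ (π - ψ)))

/-- `crown` is symmetric under `ψ ↦ π - ψ`. [folklore] -/
theorem crown_symm (ψ : ℝ) : crown (π - ψ) = crown ψ := by
  unfold crown
  rw [sub_sub_cancel, min_comm]

/-- For `ψ ≤ π/2`, `crown ψ = (π/2) log(π/(2ψ))`. [folklore] -/
theorem crown_of_le {ψ : ℝ} (h : ψ ≤ π / 2) : crown ψ = π / 2 * Real.log (π / (2 * ψ)) := by
  unfold crown
  rw [min_eq_left (by linarith)]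

/-- `crown ψ ≥ 0` on `(0, π)`. [folklore] -/
theorem crown_nonneg {ψ : ℝ} (h0 : 0 < ψ) (hπ : ψ < π) : 0 ≤ crown ψ := by
  unfold crown
  have hm : 0 < min ψ (π - ψ) := lt_min h0 (by linarith)
  have hm2 : min ψ (π - ψ) ≤ π / 2 := by
    rcases le_total ψ (π / 2) with h | h
    · exact (min_le_left _ _).trans h
    · exact (min_le_right _ _).trans (by linarith)
  refine mul_nonneg (by linarith [Real.pi_pos]) (Real.log_nonneg ?_)
  rw [le_div_iff₀ (by linarith)]
  linarith

/-! ### Level crossings of a continuous function -/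

/-- **Last crossing before a dip**: if `ψ a ≥ d > ψ b`, there is a last `x_a ∈ [a, b)` with
`ψ x_a = d`, after which `ψ < d` up to `b`. [folklore] -/
theorem exists_last_crossing {ψ : ℝ → ℝ} {a b d : ℝ} (hab : a ≤ b) (hc : ContinuousOn ψ (Icc a b))
    (ha : d ≤ ψ a) (hb : ψ b < d) :
    ∃ xa ∈ Ico a b, ψ xa = d ∧ ∀ x ∈ Ioc xa b, ψ x < d := by
  set S : Set ℝ := Icc a b ∩ ψ ⁻¹' Ici d with hS
  have hSc : IsClosed S := hc.preimage_isClosed_of_isClosed isClosed_Icc isClosed_Ici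
  have hSn : S.Nonempty := ⟨a, left_mem_Icc.2 hab, ha⟩
  have hSb : BddAbove S := ⟨b, fun x hx ↦ hx.1.2⟩
  set xa := sSup S with hxa
  have hmem : xa ∈ S := hSc.csSup_mem hSn hSb
  have hxab : xa ≤ b := csSup_le hSn fun x hx ↦ hx.1.2
  have hne : xa ≠ b := by
    rintro h
    have : d ≤ ψ b := by rw [← h]; exact hmem.2
    linarith
  have hlt : xa < b := lt_of_le_of_ne hxab hne
  have hafter : ∀ x ∈ Ioc xa b, ψ x < d := by
    intro x hx
    by_contra hge
    rw [not_lt] at hge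
    have hxS : x ∈ S := ⟨⟨hmem.1.1.trans hx.1.le, hx.2⟩, hge⟩
    exact absurd (le_csSup hSb hxS) (not_le.2 hx.1)
  refine ⟨xa, ⟨hmem.1.1, hlt⟩, le_antisymm ?_ hmem.2, hafter⟩
  -- `ψ xa ≤ d` by continuity from the right
  have hcw : ContinuousWithinAt ψ (Ioc xa b) xa :=
    (hc xa hmem.1).mono fun x hx ↦ ⟨hmem.1.1.trans hx.1.le, hx.2⟩
  have hbot : (𝓝[Ioc xa b] xa).NeBot := by
    rw [nhdsWithin_Ioc_eq_nhdsGT hlt]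
    infer_instance
  refine le_of_tendsto hcw.tendsto ?_
  filter_upwards [self_mem_nhdsWithin] with x hx using (hafter x hx).le

/-- **First crossing after a dip**: if `ψ a < d ≤ ψ b`, there is a first `x_b ∈ (a, b]` with
`ψ x_b = d`, before which `ψ < d` from `a` on. [folklore] -/
theorem exists_first_crossing {ψ : ℝ → ℝ} {a b d : ℝ} (hab : a ≤ b) (hc : ContinuousOn ψ (Icc a b))
    (ha : ψ a < d) (hb : d ≤ ψ b) :
    ∃ xb ∈ Ioc a b, ψ xb = d ∧ ∀ x ∈ Ico a xb, ψ x < d := by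
  set S : Set ℝ := Icc a b ∩ ψ ⁻¹' Ici d with hS
  have hSc : IsClosed S := hc.preimage_isClosed_of_isClosed isClosed_Icc isClosed_Ici
  have hSn : S.Nonempty := ⟨b, right_mem_Icc.2 hab, hb⟩
  have hSb : BddBelow S := ⟨a, fun x hx ↦ hx.1.1⟩
  set xb := sInf S with hxb
  have hmem : xb ∈ S := hSc.csInf_mem hSn hSb
  have hxab : a ≤ xb := le_csInf hSn fun x hx ↦ hx.1.1
  have hne : xb ≠ a := by
    rintro h
    have : d ≤ ψ a := by rw [← h]; exact hmem.2
    linarith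
  have hlt : a < xb := lt_of_le_of_ne hxab (Ne.symm hne)
  have hbefore : ∀ x ∈ Ico a xb, ψ x < d := by
    intro x hx
    by_contra hge
    rw [not_lt] at hge
    have hxS : x ∈ S := ⟨⟨hx.1, hx.2.le.trans hmem.1.2⟩, hge⟩
    exact absurd (csInf_le hSb hxS) (not_le.2 hx.2)
  refine ⟨xb, ⟨hlt, hmem.1.2⟩, le_antisymm ?_ hmem.2, hbefore⟩
  have hcw : ContinuousWithinAt ψ (Ico a xb) xb :=
    (hc xb hmem.1).mono fun x hx ↦ ⟨hx.1, hx.2.le.trans hmem.1.2⟩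
  have hbot : (𝓝[Ico a xb] xb).NeBot := by
    rw [nhdsWithin_Ico_eq_nhdsLT hlt]
    infer_instance
  refine le_of_tendsto hcw.tendsto ?_
  filter_upwards [self_mem_nhdsWithin] with x hx using (hbefore x hx).le

/-! ### Quasi-geodesics in polar coordinates -/

/-- **A quasi-geodesic of `ℍ` ending at `0`, in polar coordinates** `ψ = arg w`, `R = -log ‖w‖`
along `[x₀, 1)`: hyperbolic speed `≤ α/(1-x)` (`|ψ'|, |R'| ≤ sin ψ · α/(1-x)`), the distance
inequality with constants `β, C`, and `R → +∞`. [folklore] -/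
structure IsQuasiGeodesic (ψ ψ' R R' : ℝ → ℝ) (x₀ α β C : ℝ) : Prop where
  lt_one : x₀ < 1
  α_pos : 0 < α
  β_pos : 0 < β
  mem_Ioo : ∀ x ∈ Ico x₀ 1, ψ x ∈ Ioo 0 π
  hasDerivAt_ψ : ∀ x ∈ Ico x₀ 1, HasDerivAt ψ (ψ' x) x
  abs_ψ'_le : ∀ x ∈ Ico x₀ 1, |ψ' x| ≤ Real.sin (ψ x) * (α / (1 - x))
  hasDerivAt_R : ∀ x ∈ Ico x₀ 1, HasDerivAt R (R' x) x
  abs_R'_le : ∀ x ∈ Ico x₀ 1, |R' x| ≤ Real.sin (ψ x) * (α / (1 - x))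
  dist_le : ∀ x₁ x₂, x₀ ≤ x₁ → x₁ ≤ x₂ → x₂ < 1 →
    β * Real.log ((1 - x₁) / (1 - x₂)) - C ≤ crown (ψ x₁) + |R x₂ - R x₁| + crown (ψ x₂)
  tendsto_R : Tendsto R (𝓝[<] 1) atTop

namespace IsQuasiGeodesic

variable {ψ ψ' R R' : ℝ → ℝ} {x₀ α β C : ℝ}

/-- The reflected curve `ψ ↦ π - ψ` is again a quasi-geodesic with the same constants. [folklore] -/
theorem symm (h : IsQuasiGeodesic ψ ψ' R R' x₀ α β C) :
    IsQuasiGeodesic (fun x ↦ π - ψ x) (fun x ↦ -ψ' x) R R' x₀ α β C where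
  lt_one := h.lt_one
  α_pos := h.α_pos
  β_pos := h.β_pos
  mem_Ioo x hx := by
    have := h.mem_Ioo x hx
    exact ⟨by linarith [this.2], by linarith [this.1]⟩
  hasDerivAt_ψ x hx := by
    have := (h.hasDerivAt_ψ x hx).const_sub π
    simpa using this
  abs_ψ'_le x hx := by
    rw [abs_neg, Real.sin_pi_sub]
    exact h.abs_ψ'_le x hx
  hasDerivAt_R := h.hasDerivAt_R
  abs_R'_le x hx := by
    rw [Real.sin_pi_sub]
    exact h.abs_R'_le x hx
  dist_le x₁ x₂ h₁ h₁₂ h₂ := by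
    simp only [crown_symm]
    exact h.dist_le x₁ x₂ h₁ h₁₂ h₂
  tendsto_R := h.tendsto_R

/-- `ψ` is continuous on `[x₀, 1)`. [folklore] -/
theorem continuousOn_ψ (h : IsQuasiGeodesic ψ ψ' R R' x₀ α β C) : ContinuousOn ψ (Ico x₀ 1) :=
  fun x hx ↦ (h.hasDerivAt_ψ x hx).continuousAt.continuousWithinAt

/-- **Angular variation**: the angular potential is `α/(1-x)`-Lipschitz along the curve,
`|Φ(ψ x₂) - Φ(ψ x₁)| ≤ α log((1-x₁)/(1-x₂))`. [folklore] -/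
theorem abs_angPot_sub_le (h : IsQuasiGeodesic ψ ψ' R R' x₀ α β C) {x₁ x₂ : ℝ} (h₁ : x₀ ≤ x₁)
    (h₁₂ : x₁ ≤ x₂) (h₂ : x₂ < 1) :
    |angPot (ψ x₂) - angPot (ψ x₁)| ≤ α * Real.log ((1 - x₁) / (1 - x₂)) := by
  have hsub : Icc x₁ x₂ ⊆ Ico x₀ 1 := fun x hx ↦ ⟨h₁.trans hx.1, lt_of_le_of_lt hx.2 h₂⟩
  have hB : ∀ x ∈ Icc x₁ x₂, HasDerivAt (fun x ↦ -α * Real.log (1 - x)) (α / (1 - x)) x := by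
    intro x hx
    have hx1 : 1 - x ≠ 0 := by linarith [(hsub hx).2]
    have h1 : HasDerivAt (fun x ↦ Real.log (1 - x)) ((-1) / (1 - x)) x := by
      have := ((hasDerivAt_id x).const_sub 1).log hx1
      simpa using this
    exact (h1.const_mul (-α)).congr_deriv (by ring)
  have hg : ∀ x ∈ Icc x₁ x₂, HasDerivAt (fun x ↦ angPot (ψ x)) (1 / Real.sin (ψ x) * ψ' x) x := by
    intro x hx
    have hI := h.mem_Ioo x (hsub hx)
    exact (hasDerivAt_angPot hI.1 hI.2).comp x (h.hasDerivAt_ψ x (hsub hx))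
  have hle : ∀ x ∈ Icc x₁ x₂, |1 / Real.sin (ψ x) * ψ' x| ≤ α / (1 - x) := by
    intro x hx
    have hI := h.mem_Ioo x (hsub hx)
    have hs : 0 < Real.sin (ψ x) := Real.sin_pos_of_pos_of_lt_pi hI.1 hI.2
    have hb := h.abs_ψ'_le x (hsub hx)
    rw [abs_mul, abs_of_pos (by positivity : 0 < 1 / Real.sin (ψ x)), one_div, inv_mul_le_iff₀ hs]
    exact hb
  have := abs_sub_le_of_abs_deriv_le h₁₂ hg hB hle
  have hx1 : 0 < 1 - x₁ := by linarith
  have hx2 : 0 < 1 - x₂ := by linarith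
  rw [Real.log_div hx1.ne' hx2.ne']
  linarith

/-- **Radial variation under an angle bound**: if `sin ψ ≤ s` on `[x₁, x₂]` then
`|R x₂ - R x₁| ≤ s α log((1-x₁)/(1-x₂))`. [folklore] -/
theorem abs_R_sub_le (h : IsQuasiGeodesic ψ ψ' R R' x₀ α β C) {x₁ x₂ s : ℝ} (h₁ : x₀ ≤ x₁)
    (h₁₂ : x₁ ≤ x₂) (h₂ : x₂ < 1) (hsin : ∀ x ∈ Icc x₁ x₂, Real.sin (ψ x) ≤ s) :
    |R x₂ - R x₁| ≤ s * α * Real.log ((1 - x₁) / (1 - x₂)) := by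
  have hsub : Icc x₁ x₂ ⊆ Ico x₀ 1 := fun x hx ↦ ⟨h₁.trans hx.1, lt_of_le_of_lt hx.2 h₂⟩
  have hB : ∀ x ∈ Icc x₁ x₂, HasDerivAt (fun x ↦ -(s * α) * Real.log (1 - x)) (s * α / (1 - x)) x := by
    intro x hx
    have hx1 : 1 - x ≠ 0 := by linarith [(hsub hx).2]
    have h1 : HasDerivAt (fun x ↦ Real.log (1 - x)) ((-1) / (1 - x)) x := by
      have := ((hasDerivAt_id x).const_sub 1).log hx1
      simpa using this
    exact (h1.const_mul (-(s * α))).congr_deriv (by ring)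
  have hle : ∀ x ∈ Icc x₁ x₂, |R' x| ≤ s * α / (1 - x) := by
    intro x hx
    have hx1 : 0 < 1 - x := by linarith [(hsub hx).2]
    have hb := h.abs_R'_le x (hsub hx)
    have hαx : 0 ≤ α / (1 - x) := div_nonneg h.α_pos.le hx1.le
    calc |R' x| ≤ Real.sin (ψ x) * (α / (1 - x)) := hb
      _ ≤ s * (α / (1 - x)) := mul_le_mul_of_nonneg_right (hsin x hx) hαx
      _ = s * α / (1 - x) := by ring
  have := abs_sub_le_of_abs_deriv_le h₁₂ (fun x hx ↦ h.hasDerivAt_R x (hsub hx)) hB hle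
  have hx1 : 0 < 1 - x₁ := by linarith
  have hx2 : 0 < 1 - x₂ := by linarith
  rw [Real.log_div hx1.ne' hx2.ne']
  linarith

/-- The level `δ' = min(π/6, β/(2α))`: `α sin δ' ≤ β/2`. [folklore] -/
def level (_h : IsQuasiGeodesic ψ ψ' R R' x₀ α β C) : ℝ := min (π / 6) (β / (2 * α))

/-- `δ' > 0`. [folklore] -/
theorem level_pos (h : IsQuasiGeodesic ψ ψ' R R' x₀ α β C) : 0 < h.level :=
  lt_min (by positivity) (div_pos h.β_pos (by linarith [h.α_pos]))

/-- `δ' ≤ π/6`. [folklore] -/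
theorem level_le (h : IsQuasiGeodesic ψ ψ' R R' x₀ α β C) : h.level ≤ π / 6 := min_le_left _ _

/-- `α sin δ' ≤ β/2`. [folklore] -/
theorem mul_sin_level_le (h : IsQuasiGeodesic ψ ψ' R R' x₀ α β C) :
    α * Real.sin h.level ≤ β / 2 := by
  have h1 : Real.sin h.level ≤ h.level := Real.sin_le h.level_pos.le
  have h2 : h.level ≤ β / (2 * α) := min_le_right _ _
  have h3 : α * h.level ≤ β / 2 := by
    rw [le_div_iff₀ (by linarith [h.α_pos])] at h2
    linarith
  nlinarith [h.α_pos]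

/-- `sin ψ ≤ sin δ'` when `0 ≤ ψ ≤ δ' ≤ π/6`. [folklore] -/
theorem sin_le_sin_level (h : IsQuasiGeodesic ψ ψ' R R' x₀ α β C) {t : ℝ} (ht0 : 0 ≤ t)
    (ht : t ≤ h.level) : Real.sin t ≤ Real.sin h.level :=
  Real.sin_le_sin_of_le_of_le_pi_div_two (by linarith [Real.pi_pos])
    (by linarith [h.level_le, Real.pi_pos]) ht

/-- **Step 1: the angle does not stay below the level `δ'` up to `1`.** Otherwise the distance
inequality forces `crown (ψ x) ≥ (β/2) log((1-x₁)/(1-x)) - C₁`, a power decay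
`ψ x ≤ M (1-x)^{β/π}`, so `|R'| ≤ M α (1-x)^{β/π - 1}` is integrable and `R` stays bounded,
contradicting `R → ∞`. [folklore] -/
theorem exists_level_le (h : IsQuasiGeodesic ψ ψ' R R' x₀ α β C) {x₁ : ℝ} (hx₁ : x₁ ∈ Ico x₀ 1) :
    ∃ x ∈ Ico x₁ 1, h.level ≤ ψ x := by
  by_contra hnot
  push Not at hnot
  -- notation
  set δ' := h.level with hδ'
  have hδ'pos := h.level_pos
  have hδ'le := h.level_le
  have hκ : β / 2 ≤ β - α * Real.sin δ' := by linarith [h.mul_sin_level_le]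
  have hx₁1 : 0 < 1 - x₁ := by linarith [hx₁.2]
  set C₁ : ℝ := C + crown (ψ x₁) with hC₁
  set κ' : ℝ := β / π with hκ'
  have hκ'pos : 0 < κ' := div_pos h.β_pos Real.pi_pos
  -- the power decay of `ψ`
  set M : ℝ := π / 2 * Real.exp (2 / π * C₁ - κ' * Real.log (1 - x₁)) with hM
  have hMpos : 0 < M := by positivity
  have hdecay : ∀ x ∈ Ico x₁ 1, ψ x ≤ M * Real.exp (κ' * Real.log (1 - x)) := by
    intro x hx
    have hx0 : x ∈ Ico x₀ 1 := ⟨hx₁.1.trans hx.1, hx.2⟩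
    have hx1 : 0 < 1 - x := by linarith [hx.2]
    have hψx := hnot x hx
    have hIx := h.mem_Ioo x hx0
    set Y := Real.log ((1 - x₁) / (1 - x)) with hY
    have hY0 : 0 ≤ Y := Real.log_nonneg (by rw [le_div_iff₀ hx1]; linarith [hx.1])
    -- `|R x - R x₁| ≤ sin δ' α Y`
    have hRvar : |R x - R x₁| ≤ Real.sin δ' * α * Y :=
      h.abs_R_sub_le hx₁.1 hx.1 hx.2
        fun t ht ↦ h.sin_le_sin_level (h.mem_Ioo t ⟨hx₁.1.trans ht.1, lt_of_le_of_lt ht.2 hx.2⟩).1.le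
          (hnot t ⟨ht.1, lt_of_le_of_lt ht.2 hx.2⟩).le
    -- the distance inequality
    have hdist := h.dist_le x₁ x hx₁.1 hx.1 hx.2
    rw [← hY] at hdist
    have hcr : crown (ψ x) = π / 2 * Real.log (π / (2 * ψ x)) :=
      crown_of_le (by linarith [Real.pi_pos])
    have h1 : β / 2 * Y - C₁ ≤ π / 2 * Real.log (π / (2 * ψ x)) := by
      rw [← hcr]
      have : (β - α * Real.sin δ') * Y ≤ C₁ + crown (ψ x) := by nlinarith
      nlinarith
    -- solve for `ψ x`
    set E : ℝ := κ' * Y - 2 / π * C₁ with hE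
    have h2 : E ≤ Real.log (π / (2 * ψ x)) := by
      have hπ2 : 0 < π / 2 := by positivity
      have := div_le_div_of_nonneg_right h1 hπ2.le
      have e1 : (β / 2 * Y - C₁) / (π / 2) = E := by
        rw [hE, hκ']; field_simp
      have e2 : π / 2 * Real.log (π / (2 * ψ x)) / (π / 2) = Real.log (π / (2 * ψ x)) := by
        field_simp
      rw [e1, e2] at this
      exact this
    have h3 : Real.exp E ≤ π / (2 * ψ x) := by
      have := Real.exp_le_exp.2 h2
      rwa [Real.exp_log (by have := hIx.1; positivity)] at this
    have hψ0 : ψ x ≠ 0 := hIx.1.ne'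
    have h4 : ψ x * Real.exp E ≤ π / 2 := by
      calc ψ x * Real.exp E ≤ ψ x * (π / (2 * ψ x)) := mul_le_mul_of_nonneg_left h3 hIx.1.le
        _ = π / 2 := by field_simp
    have h5 : M * Real.exp (κ' * Real.log (1 - x)) = π / 2 / Real.exp E := by
      rw [hM, mul_assoc, ← Real.exp_add, hE, hY, Real.log_div hx₁1.ne' hx1.ne',
        show 2 / π * C₁ - κ' * Real.log (1 - x₁) + κ' * Real.log (1 - x) =
          -(κ' * (Real.log (1 - x₁) - Real.log (1 - x)) - 2 / π * C₁) by ring, Real.exp_neg]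
      simp only [div_eq_mul_inv]
    rw [h5, le_div_iff₀ (Real.exp_pos E)]
    exact h4
  -- the integrable bound for `R'` and its antiderivative
  set B : ℝ → ℝ := fun x ↦ -(M * α / κ') * Real.exp (κ' * Real.log (1 - x)) with hB
  have hBderiv : ∀ x ∈ Ico x₁ 1,
      HasDerivAt B (M * Real.exp (κ' * Real.log (1 - x)) * (α / (1 - x))) x := by
    intro x hx
    have hx1 : 1 - x ≠ 0 := by linarith [hx.2]
    have h1 : HasDerivAt (fun x ↦ Real.log (1 - x)) ((-1) / (1 - x)) x := by
      have := ((hasDerivAt_id x).const_sub 1).log hx1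
      simpa using this
    have h2 := ((h1.const_mul κ').exp).const_mul (-(M * α / κ'))
    refine h2.congr_deriv ?_
    field_simp
  have hBle : ∀ x ∈ Ico x₁ 1, |R' x| ≤ M * Real.exp (κ' * Real.log (1 - x)) * (α / (1 - x)) := by
    intro x hx
    have hx0 : x ∈ Ico x₀ 1 := ⟨hx₁.1.trans hx.1, hx.2⟩
    have hx1 : 0 < 1 - x := by linarith [hx.2]
    have hIx := h.mem_Ioo x hx0
    have hαx : 0 ≤ α / (1 - x) := div_nonneg h.α_pos.le hx1.le
    calc |R' x| ≤ Real.sin (ψ x) * (α / (1 - x)) := h.abs_R'_le x hx0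
      _ ≤ ψ x * (α / (1 - x)) := mul_le_mul_of_nonneg_right (Real.sin_le hIx.1.le) hαx
      _ ≤ M * Real.exp (κ' * Real.log (1 - x)) * (α / (1 - x)) :=
        mul_le_mul_of_nonneg_right (hdecay x hx) hαx
  have hBnonpos : ∀ x, B x ≤ 0 := fun x ↦ by
    rw [hB]
    have : 0 ≤ M * α / κ' * Real.exp (κ' * Real.log (1 - x)) := by
      have := h.α_pos; positivity
    linarith
  -- `R` is bounded above on `[x₁, 1)`
  have hRbdd : ∀ x ∈ Ico x₁ 1, R x ≤ R x₁ - B x₁ := by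
    intro x hx
    have hsub : Icc x₁ x ⊆ Ico x₁ 1 := fun t ht ↦ ⟨ht.1, lt_of_le_of_lt ht.2 hx.2⟩
    have := abs_sub_le_of_abs_deriv_le hx.1
      (fun t ht ↦ h.hasDerivAt_R t ⟨hx₁.1.trans (hsub ht).1, (hsub ht).2⟩)
      (fun t ht ↦ hBderiv t (hsub ht)) (fun t ht ↦ hBle t (hsub ht))
    linarith [(abs_le.1 this).2, hBnonpos x]
  -- contradiction with `R → ∞`
  have hev := (tendsto_atTop.1 h.tendsto_R) (R x₁ - B x₁ + 1)
  obtain ⟨x, hx, hxI⟩ := (hev.and (Ico_mem_nhdsLT hx₁.2)).exists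
  linarith [hRbdd x hxI]

/-- **Step 2: dips below the level are shallow.** Past a point `x_m` with `ψ x_m ≥ δ'`, every
`x` with `ψ x < δ'` lies in a dip `[x_a, x_b]` between two crossings of the level; the distance
inequality on `[x_a, x_b]` (where `|ΔR| ≤ α sin δ' log((1-x_a)/(1-x_b))`) bounds
`log((1-x_a)/(1-x_b))`, and the angular potential then drops by a bounded amount on `[x_a, x]`.
[folklore] -/
theorem level_dip (h : IsQuasiGeodesic ψ ψ' R R' x₀ α β C) {xm : ℝ} (hxm : xm ∈ Ico x₀ 1)
    (hψm : h.level ≤ ψ xm) {x : ℝ} (hx : x ∈ Ico xm 1) (hψx : ψ x < h.level) :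
    angPot h.level - α * ((max C 0 + 2 * crown h.level) / (β / 2)) ≤ angPot (ψ x) := by
  set δ' := h.level with hδ'
  have hδ'pos := h.level_pos
  have hδ'le := h.level_le
  have hκ : β / 2 ≤ β - α * Real.sin δ' := by linarith [h.mul_sin_level_le]
  set Ymax : ℝ := (max C 0 + 2 * crown δ') / (β / 2) with hYmax
  have hx0 : x ∈ Ico x₀ 1 := ⟨hxm.1.trans hx.1, hx.2⟩
  -- the last crossing `x_a` before `x`
  have hcont : ContinuousOn ψ (Icc xm x) :=
    h.continuousOn_ψ.mono fun t ht ↦ ⟨hxm.1.trans ht.1, lt_of_le_of_lt ht.2 hx.2⟩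
  obtain ⟨xa, hxa, hψa, hafter⟩ := exists_last_crossing hx.1 hcont hψm hψx
  -- a later point above the level, and the first crossing `x_b` after `x`
  obtain ⟨xe, hxe, hψe⟩ := h.exists_level_le hx0
  have hcont' : ContinuousOn ψ (Icc x xe) :=
    h.continuousOn_ψ.mono fun t ht ↦ ⟨hx0.1.trans ht.1, lt_of_le_of_lt ht.2 hxe.2⟩
  obtain ⟨xb, hxb, hψb, hbefore⟩ := exists_first_crossing hxe.1 hcont' hψx hψe
  -- positions
  have hxa0 : x₀ ≤ xa := hxm.1.trans hxa.1
  have hab : xa ≤ xb := (hxa.2.le).trans hxb.1.le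
  have hxb1 : xb < 1 := lt_of_le_of_lt hxb.2 hxe.2
  have hxa1 : 0 < 1 - xa := by linarith [hxa.2, hx.2]
  have hxb1' : 0 < 1 - xb := by linarith
  -- `ψ ≤ δ'` on `[x_a, x_b]`
  have hlow : ∀ t ∈ Icc xa xb, ψ t ≤ δ' := by
    intro t ht
    rcases eq_or_lt_of_le ht.1 with rfl | hat
    · exact hψa.le
    rcases le_or_gt t x with htx | htx
    · exact (hafter t ⟨hat, htx⟩).le
    rcases eq_or_lt_of_le ht.2 with rfl | htb
    · exact hψb.le
    · exact (hbefore t ⟨htx.le, htb⟩).le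
  -- the dip is short: `Y ≤ Ymax`
  set Y := Real.log ((1 - xa) / (1 - xb)) with hY
  have hY0 : 0 ≤ Y := Real.log_nonneg (by rw [le_div_iff₀ hxb1']; linarith)
  have hRvar : |R xb - R xa| ≤ Real.sin δ' * α * Y :=
    h.abs_R_sub_le hxa0 hab hxb1
      fun t ht ↦ h.sin_le_sin_level (h.mem_Ioo t ⟨hxa0.trans ht.1, lt_of_le_of_lt ht.2 hxb1⟩).1.le
        (hlow t ht)
  have hdist := h.dist_le xa xb hxa0 hab hxb1
  rw [← hY, hψa, hψb] at hdist
  have hYle : Y ≤ Ymax := by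
    have h1 : (β - α * Real.sin δ') * Y ≤ max C 0 + 2 * crown δ' := by
      nlinarith [le_max_left C 0]
    have h2 : β / 2 * Y ≤ max C 0 + 2 * crown δ' := by nlinarith
    rw [hYmax, le_div_iff₀ (by linarith [h.β_pos])]
    linarith
  -- the angular potential on `[x_a, x]`
  have hang := h.abs_angPot_sub_le hxa0 hxa.2.le hx.2
  rw [hψa] at hang
  have hlog : Real.log ((1 - xa) / (1 - x)) ≤ Y := by
    rw [hY]
    refine Real.log_le_log (div_pos hxa1 (by linarith [hx.2])) ?_
    exact div_le_div_of_nonneg_left hxa1.le hxb1' (by linarith [hxb.1])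
  have h3 : α * Real.log ((1 - xa) / (1 - x)) ≤ α * Ymax :=
    mul_le_mul_of_nonneg_left (hlog.trans hYle) h.α_pos.le
  linarith [(abs_le.1 hang).1]

/-- **One-sided conclusion: the angle is eventually bounded below.** [folklore] -/
theorem eventually_le (h : IsQuasiGeodesic ψ ψ' R R' x₀ α β C) :
    ∃ δ > 0, ∃ x₁ ∈ Ico x₀ 1, ∀ x ∈ Ico x₁ 1, δ ≤ ψ x := by
  set δ' := h.level with hδ'
  have hδ'pos := h.level_pos
  have hδ'le := h.level_le
  obtain ⟨xm, hxm, hψm⟩ := h.exists_level_le (x₁ := x₀) ⟨le_rfl, h.lt_one⟩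
  set L : ℝ := angPot δ' - α * ((max C 0 + 2 * crown δ') / (β / 2)) with hL
  set δ : ℝ := min δ' (Real.exp (L - 1)) with hδ
  have hδpos : 0 < δ := lt_min hδ'pos (Real.exp_pos _)
  refine ⟨δ, hδpos, xm, hxm, fun x hx ↦ ?_⟩
  by_cases hψx : δ' ≤ ψ x
  · exact (min_le_left _ _).trans hψx
  rw [not_le] at hψx
  have hdip := h.level_dip hxm hψm hx hψx
  rw [← hL] at hdip
  by_contra hlt
  rw [not_le] at hlt
  have hx0 : x ∈ Ico x₀ 1 := ⟨hxm.1.trans hx.1, hx.2⟩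
  have hIx := h.mem_Ioo x hx0
  have h1 : angPot (ψ x) ≤ Real.log (ψ x) :=
    angPot_le_log hIx.1 (by linarith [Real.pi_pos])
  have h2 : Real.log (ψ x) < Real.log δ := Real.log_lt_log hIx.1 hlt
  have h3 : Real.log δ ≤ L - 1 := by
    calc Real.log δ ≤ Real.log (Real.exp (L - 1)) :=
          Real.log_le_log hδpos (min_le_right _ _)
      _ = L - 1 := Real.log_exp _
  linarith

/-- **Quasi-geodesics of `ℍ` end non-tangentially**: `δ ≤ ψ ≤ π - δ` near `1`, for some `δ > 0`.
[folklore] -/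
theorem eventually_mem_Icc (h : IsQuasiGeodesic ψ ψ' R R' x₀ α β C) :
    ∃ δ > 0, ∃ x₁ ∈ Ico x₀ 1, ∀ x ∈ Ico x₁ 1, δ ≤ ψ x ∧ ψ x ≤ π - δ := by
  obtain ⟨δ₁, hδ₁, x₁, hx₁, h₁⟩ := h.eventually_le
  obtain ⟨δ₂, hδ₂, x₂, hx₂, h₂⟩ := h.symm.eventually_le
  refine ⟨min δ₁ δ₂, lt_min hδ₁ hδ₂, max x₁ x₂, ⟨le_max_of_le_left hx₁.1, max_lt hx₁.2 hx₂.2⟩,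
    fun x hx ↦ ⟨?_, ?_⟩⟩
  · exact (min_le_left _ _).trans (h₁ x ⟨(le_max_left _ _).trans hx.1, hx.2⟩)
  · have := h₂ x ⟨(le_max_right _ _).trans hx.1, hx.2⟩
    linarith [min_le_right δ₁ δ₂]

end IsQuasiGeodesic


end QuasiGeodesic

end Literature.Analysis.Complex
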